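/-
Copyright (c) 2026 the pub-hodgecm-mathlib formalisation cell (harness21).  Prover seat hodgecm-mathlib-R90-C14-p02 (g3) (section S6, dealer R90-C14-plan (g2),
card (G1) «E1-DISCHARGE», R90 bus 2026-09-05T03:03:11Z; census `R90/R90-C14-p02/g3/G1-DISCHARGE-CENSUS.md` 7afcecd4, rulings (Q1)(Q2) + «PLAN =» 03:09:36Z).
FILE 2 = the regime R-III (residually separated) DISCHARGE of typ1's (E1) target IN VALUES.  THEOREMS ONLY (no `def`, no `instance`, no notation, no named-fact
hypothesis, no `sorry`); lane `--supports stmt-HodgeConjecture-24833 --as helper` (count-neutral helper).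
-/
import Summits.HodgeConjecture.HodgeConjecture.Theorems.R90S6EllipticIdentityTypeOneReduction   -- ★ FILE 1b (this seat): (E1) ⟸ (U0) ∧ (U1); brings FILE 1a
import Summits.HodgeConjecture.HodgeConjecture.Theorems.R90S6FlickerLiteralCounts              -- ★ counts B p864976: `flickerFrame_natCard_fixedBy_{one,pi}_of_separated`
import Literature.NumberTheory.Automorphic.UnitaryLatticeTreeLevelIndices                      -- ★ `index_inf_subgroupOf_eq_of_unramified` (`[K₀ : K₀ ⊓ K₁] = q³ + 1`)
import HarnessLib

/-!
# R90 · S6 — CARD (G1) «E1-DISCHARGE», FILE 2: THE TYPE-(1) ELLIPTIC κ-IDENTITY (E1) IN THE RESIDUALLY SEPARATED REGIME R-III, FOR EVERY `m`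
# (`Theorems/R90S6EllipticIdentityTypeOneSeparated.lean`)

Cell `hodgecm-mathlib`, crux H413 (`stmt-HodgeConjecture-24833`), route of record `HCCMUnconditional`; programme R90-TF, section S6 (base `R90-C14`), seat
R90-C14-p02 (g3); card (G1) «E1-DISCHARGE» (dealer R90-C14-plan (g2), R90 bus 2026-09-05T03:03:11Z; «FILE 2 … GO» 03:09:36Z).
Target of record = typ1 (g3)'s (E1) `delta_mul_kappaSum_ncard_displaced_flicker_eq_sum_xiHCoeff_mul_ncard_displaced_two` (sheet v2.3 `4c174fca74d7a58a` :191).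

THE MATHEMATICS.  Regime R-III: the three eigenvalues `a, b, c ∈ K¹` of the `E¹`-type element are pairwise RESIDUALLY SEPARATED (`|a−b| = |a−c| = |b−c| = 1`).  Then
`Δ = (−q)^{log|(b−a)(b−c)|} = 1`; the fixed-coset counts of Flicker's four literals are `(V₀, V₁)(t₁) = (1, 0)` and `(V₀, V₁)(t_ϖ(·)) = (0, 1)` for the three `θ̄ = 1` literals
(★ counts B `flickerFrame_natCard_fixedBy_one_of_separated` ∕ `_pi_of_separated`, F0P2-p09); and the compression `δ₁` fixes the root of `X₂` alone (★ HF1 A3 at `n = 0` through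
★ FILE 1a `setOf_compression_fixed_eq_ball`: `Fix δ₁ = Ball(x₀, 0)`), so `Φ = 1`.  Hence (U0) `1·(1 + 0 − 0 − 0) = 1 = Φ` and (U1) `1·(0 + 1 − 1 − 1) = −1 = Φ − 2` hold, and
★ FILE 1b `…_of_unitLevels` gives (E1) at every displacement `m` (hand checks (ii)(iii) of the sheet are the cases `m = 1, 2`).  The instance letters of ★ counts B are BUILT
here (ruling (Q2)): `Fintype (Fix_γ(U⧸K₀))` from `hfin₀`, the section `r = Quotient.out`, and `Finite (K₀ ⧸ (K₀ ⊓ K₁))` — hence every `Finite (fixedBy (K₀ ⧸ (K₀ ⊓ K₁)) k)`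
— from ★ `index_inf_subgroupOf_eq_of_unramified` (`[K₀ : K₀ ⊓ K₁] = q³ + 1`); the finite-orbit letter `horbᵢ` rides named as in (E1) v2.3.
* HEAD **`delta_mul_kappaSum_ncard_displaced_flicker_eq_sum_xiHCoeff_mul_ncard_displaced_two_of_separated`**: (E1)'s conclusion BYTES VERBATIM for every `m` under the
  R-III letters `hvab hvac hvbc` — the first fully ★ stratum of row E1.3.5.2.6 type (1).
HONEST LABEL: the residually separated stratum only (`n_ab = n_ac = n_bc = 0`); the deep regimes wait on the `V₀`∕`V₁` columns (FILE 0, R2M F2∕F3) and «FLSUM» (census §2);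
count-neutral until the E1.3.9 assembly consumes (E1).  HC_CM is proved only modulo the 7 printed citations (2 remaining named inputs: hLiu418 = stmt-HodgeConjecture-24832,
h413 = stmt-HodgeConjecture-24833) until rung 0 closes; REL ≠ ★ ≠ BUILT.

## References
* [Rogawski1990] J. D. Rogawski, *Automorphic Representations of Unitary Groups in Three Variables*, Ann. of Math. Stud. 123 (1990): §4.9 Prop. 4.9.1 (b) pp. 54–55,
  Lemma 4.9.3 p. 56.
* [Flicker1998UnitaryFL] Y. Z. Flicker, *Elementary proof of the fundamental lemma for a unitary group*, Canad. J. Math. 50 (1998): §2 Prop. 3 pp. 78–79, §6 p. 95.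
* [Kottwitz1986BaseChangeUnits] R. E. Kottwitz, *Base change for unit elements of Hecke algebras*, Compositio Math. 60 (1986), §1 pp. 240–242, §3.
* [LabesseLanglands1979] J.-P. Labesse, R. P. Langlands, *L-indistinguishability for SL(2)*, Canad. J. Math. 31 (1979), §§2–3.
* [Tits1979] J. Tits, *Reductive groups over local fields*, Proc. Sympos. Pure Math. 33.1 (1979), §2.4, §3.3.3.
-/

set_option autoImplicit false
-- the mandated namespace repeats the single-problem summit's segment (`HodgeConjecture.HodgeConjecture`)
set_option linter.dupNamespace false

noncomputable section

open MulAction SimpleGraph Finset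
open scoped Valued WithZero Matrix MatrixGroups
open Literature.NumberTheory.Automorphic Literature.NumberTheory.Automorphic.HermitianLattice Literature.NumberTheory.Automorphic.UnitaryGroup
open Literature.Combinatorics.SimpleGraph

namespace Summit.HodgeConjecture.HodgeConjecture.R90.S6

section Separated

variable {K : Type} [Field K] [Valued K ℤᵐ⁰] [ValuativeRel K] [(Valued.v : Valuation K ℤᵐ⁰).Compatible] {σ : K →+* K} {ϖ : K}

/-- **`K₀ ⧸ (K₀ ⊓ K₁)` is finite** (`[K₀ : K₀ ⊓ K₁] = q³ + 1`, ★ `index_inf_subgroupOf_eq_of_unramified`) — the instance letter `[∀ x, Finite (fixedBy (K₀ ⧸ (K₀ ⊓ K₁)) k_x)]` of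
the ★ rungs ∕ ★ counts B follows (`Subtype.finite`). [cite: Tits1979, §2.4] [cite: Kottwitz1986BaseChangeUnits, §3] -/
theorem finite_quotient_glInt_inf_conj_glInt (hd : UnramifiedLocalConjDatum σ ϖ) (hσO : ∀ x : 𝒪[K], σ x ∈ 𝒪[K]) (σk : 𝓀[K] →+* 𝓀[K])
    (hσk : ∀ x : 𝒪[K], IsLocalRing.residue 𝒪[K] ⟨σ x, hσO x⟩ = σk (IsLocalRing.residue 𝒪[K] x))
    [Fintype 𝓀[K]] {q : ℕ} (hq : Fintype.card 𝓀[K] = q ^ 2) (hfrob : ∀ y, σk y = y ^ q)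
    (g₁ : GL (Fin 3) K) (hg₁ : (g₁ : Matrix (Fin 3) (Fin 3) K) = Matrix.diagonal ![(1 : K), 1, ϖ]) :
    Finite (↥((glInt 3 K).subgroupOf (unitaryGroupOfForm σ ((StdForm.antidiagonal 3).over K))) ⧸
      (((glInt 3 K).subgroupOf (unitaryGroupOfForm σ ((StdForm.antidiagonal 3).over K)) ⊓
        ((glInt 3 K).map (MulAut.conj g₁).toMonoidHom).subgroupOf (unitaryGroupOfForm σ ((StdForm.antidiagonal 3).over K))).subgroupOf
        ((glInt 3 K).subgroupOf (unitaryGroupOfForm σ ((StdForm.antidiagonal 3).over K))))) := by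
  haveI : (((glInt 3 K).subgroupOf (unitaryGroupOfForm σ ((StdForm.antidiagonal 3).over K)) ⊓
        ((glInt 3 K).map (MulAut.conj g₁).toMonoidHom).subgroupOf (unitaryGroupOfForm σ ((StdForm.antidiagonal 3).over K))).subgroupOf
        ((glInt 3 K).subgroupOf (unitaryGroupOfForm σ ((StdForm.antidiagonal 3).over K)))).FiniteIndex :=
    ⟨by rw [(UnitaryLatticeTree.index_inf_subgroupOf_eq_of_unramified hd hσO σk hσk hq hfrob g₁ hg₁).1]; exact Nat.succ_ne_zero _⟩
  exact Subgroup.finite_quotient_of_finiteIndex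

-- the quotient-action instances `MulAction ↥K₀ (↥K₀ ⧸ I.subgroupOf K₀)` inside the ★ counts-B binders exceed the default synthesis budget (same options as ★ counts B)
set_option synthInstance.maxHeartbeats 400000 in
set_option maxHeartbeats 1600000 in
/-- **(E1) IN REGIME R-III, EVERY `m`.**  Under typ1's (E1) letters (v2.3) — the cell's unramified datum with the residual letters, `|2| = 1`, `2e = 1`, norm-one `a, b, c`,
Flicker's four literals `γ₁…γ₄`, the compressions `δ₁, δ₂`, `g₁ hg₁`, the coset-finiteness letters `hfin₀ᵢ hfin₁ᵢ` and the finite-orbit letters `horbᵢ`, the `X₂` root and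
`(q+1)`-regularity `x₀ hx₀ hloc hreg` — and the R-III regime letters `|a−b| = |a−c| = |b−c| = 1`: (E1)'s conclusion at displacement `m`.  Proof: ★ FILE 1b at (U0), (U1)
with `V(t₁) = (1,0)`, `V(t_ϖ(a,b,c)) = V(t_ϖ(a,c,b)) = V(t_ϖ(b,a,c)) = (0,1)` (★ counts B), `Φ = #Ball(x₀, 0) = 1` (★ FILE 1a ∕ ★ HF1 A3), `Δ = (−q)^0 = 1`.
[cite: Rogawski1990, §4.9 Prop. 4.9.1 (b) pp. 54–55] [cite: Flicker1998UnitaryFL, §2 Prop. 3 pp. 78–79; §6 p. 95] [cite: Kottwitz1986BaseChangeUnits, §1 pp. 240–242]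
[cite: LabesseLanglands1979, §§2–3] -/
theorem delta_mul_kappaSum_ncard_displaced_flicker_eq_sum_xiHCoeff_mul_ncard_displaced_two_of_separated
    (hd : HermitianLattice.UnramifiedLocalConjDatum σ ϖ)
    (hσO : ∀ x : 𝒪[K], σ x ∈ 𝒪[K]) (σk : 𝓀[K] →+* 𝓀[K])
    (hσk : ∀ x : 𝒪[K], IsLocalRing.residue 𝒪[K] ⟨σ x, hσO x⟩ = σk (IsLocalRing.residue 𝒪[K] x))
    [Fintype 𝓀[K]] {q : ℕ} (hq : Fintype.card 𝓀[K] = q ^ 2) (hfrob : ∀ y, σk y = y ^ q)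
    (h2 : Valued.v (2 : K) = 1) {e : K} (h2e : 2 * e = 1)
    {a b c : K} (ha : σ a * a = 1) (hb : σ b * b = 1) (hc : σ c * c = 1)
    -- regime R-III: pairwise residually separated eigenvalues
    (hvab : Valued.v (a - b) = 1) (hvac : Valued.v (a - c) = 1) (hvbc : Valued.v (b - c) = 1)
    -- Flicker's four classes of the stable class of the `E¹`-type element with eigenvalues `(a, b, c)`, `b` on the `U(1)`-slot; κ-signs `(+,+,−,−)`
    (γ₁ γ₂ γ₃ γ₄ : unitaryGroupOfForm σ ((StdForm.antidiagonal 3).over K))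
    (hγ₁ : ((γ₁ : GL (Fin 3) K) : Matrix (Fin 3) (Fin 3) K) = !![e * (a + c), 0, -(e * (a - c)); 0, b, 0; -(e * (a - c)), 0, e * (a + c)])
    (hγ₂ : ((γ₂ : GL (Fin 3) K) : Matrix (Fin 3) (Fin 3) K) = !![e * (a + c), 0, -(e * (a - c) * ϖ); 0, b, 0; -(e * (a - c) * ϖ⁻¹), 0, e * (a + c)])
    (hγ₃ : ((γ₃ : GL (Fin 3) K) : Matrix (Fin 3) (Fin 3) K) = !![e * (a + b), 0, -(e * (a - b) * ϖ); 0, c, 0; -(e * (a - b) * ϖ⁻¹), 0, e * (a + b)])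
    (hγ₄ : ((γ₄ : GL (Fin 3) K) : Matrix (Fin 3) (Fin 3) K) = !![e * (b + c), 0, -(e * (b - c) * ϖ); 0, a, 0; -(e * (b - c) * ϖ⁻¹), 0, e * (b + c)])
    -- the two classes of the stable class of the `U(1,1)`-part of `γ_H = (δ, b)`: `δ_1`, `δ_ϖ`
    (δ₁ δ₂ : unitaryGroupOfForm σ ((StdForm.antidiagonal 2).over K))
    (hδ₁ : ((δ₁ : GL (Fin 2) K) : Matrix (Fin 2) (Fin 2) K) = !![e * (a + c), -(e * (a - c)); -(e * (a - c)), e * (a + c)])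
    (hδ₂ : ((δ₂ : GL (Fin 2) K) : Matrix (Fin 2) (Fin 2) K) = !![e * (a + c), -(e * (a - c) * ϖ); -(e * (a - c) * ϖ⁻¹), e * (a + c)])
    -- ruling-(Q2) letters (typ1 v2.3): `g₁`, per literal the two coset-finiteness letters and the finite-orbit letter, the `X₂` root and its `(q+1)`-regularity
    (g₁ : GL (Fin 3) K) (hg₁ : (g₁ : Matrix (Fin 3) (Fin 3) K) = Matrix.diagonal ![(1 : K), 1, ϖ])
    (hfin₀₁ : (fixedBy (↥(unitaryGroupOfForm σ ((StdForm.antidiagonal 3).over K)) ⧸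
      (glInt 3 K).subgroupOf (unitaryGroupOfForm σ ((StdForm.antidiagonal 3).over K))) γ₁).Finite)
    (hfin₁₁ : (fixedBy (↥(unitaryGroupOfForm σ ((StdForm.antidiagonal 3).over K)) ⧸
      ((glInt 3 K).map (MulAut.conj g₁).toMonoidHom).subgroupOf (unitaryGroupOfForm σ ((StdForm.antidiagonal 3).over K))) γ₁).Finite)
    (horb₁ : (Set.range fun n : ℕ => ((γ₁ ^ n : ↥(unitaryGroupOfForm σ ((StdForm.antidiagonal 3).over K))) :
      ↥(unitaryGroupOfForm σ ((StdForm.antidiagonal 3).over K)) ⧸ (glInt 3 K).subgroupOf (unitaryGroupOfForm σ ((StdForm.antidiagonal 3).over K)))).Finite)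
    (hfin₀₂ : (fixedBy (↥(unitaryGroupOfForm σ ((StdForm.antidiagonal 3).over K)) ⧸
      (glInt 3 K).subgroupOf (unitaryGroupOfForm σ ((StdForm.antidiagonal 3).over K))) γ₂).Finite)
    (hfin₁₂ : (fixedBy (↥(unitaryGroupOfForm σ ((StdForm.antidiagonal 3).over K)) ⧸
      ((glInt 3 K).map (MulAut.conj g₁).toMonoidHom).subgroupOf (unitaryGroupOfForm σ ((StdForm.antidiagonal 3).over K))) γ₂).Finite)
    (horb₂ : (Set.range fun n : ℕ => ((γ₂ ^ n : ↥(unitaryGroupOfForm σ ((StdForm.antidiagonal 3).over K))) :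
      ↥(unitaryGroupOfForm σ ((StdForm.antidiagonal 3).over K)) ⧸ (glInt 3 K).subgroupOf (unitaryGroupOfForm σ ((StdForm.antidiagonal 3).over K)))).Finite)
    (hfin₀₃ : (fixedBy (↥(unitaryGroupOfForm σ ((StdForm.antidiagonal 3).over K)) ⧸
      (glInt 3 K).subgroupOf (unitaryGroupOfForm σ ((StdForm.antidiagonal 3).over K))) γ₃).Finite)
    (hfin₁₃ : (fixedBy (↥(unitaryGroupOfForm σ ((StdForm.antidiagonal 3).over K)) ⧸
      ((glInt 3 K).map (MulAut.conj g₁).toMonoidHom).subgroupOf (unitaryGroupOfForm σ ((StdForm.antidiagonal 3).over K))) γ₃).Finite)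
    (horb₃ : (Set.range fun n : ℕ => ((γ₃ ^ n : ↥(unitaryGroupOfForm σ ((StdForm.antidiagonal 3).over K))) :
      ↥(unitaryGroupOfForm σ ((StdForm.antidiagonal 3).over K)) ⧸ (glInt 3 K).subgroupOf (unitaryGroupOfForm σ ((StdForm.antidiagonal 3).over K)))).Finite)
    (hfin₀₄ : (fixedBy (↥(unitaryGroupOfForm σ ((StdForm.antidiagonal 3).over K)) ⧸
      (glInt 3 K).subgroupOf (unitaryGroupOfForm σ ((StdForm.antidiagonal 3).over K))) γ₄).Finite)
    (hfin₁₄ : (fixedBy (↥(unitaryGroupOfForm σ ((StdForm.antidiagonal 3).over K)) ⧸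
      ((glInt 3 K).map (MulAut.conj g₁).toMonoidHom).subgroupOf (unitaryGroupOfForm σ ((StdForm.antidiagonal 3).over K))) γ₄).Finite)
    (horb₄ : (Set.range fun n : ℕ => ((γ₄ ^ n : ↥(unitaryGroupOfForm σ ((StdForm.antidiagonal 3).over K))) :
      ↥(unitaryGroupOfForm σ ((StdForm.antidiagonal 3).over K)) ⧸ (glInt 3 K).subgroupOf (unitaryGroupOfForm σ ((StdForm.antidiagonal 3).over K)))).Finite)
    (x₀ : {M : Submodule (ValuativeRel.valuation K).integer (Fin 2 → K) // HermitianLatticeTree.IsSpecialLattice σ ϖ ((StdForm.antidiagonal 2).over K) M})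
    (hx₀ : x₀.1 = HermitianLatticeTree.latt (1 : Matrix (Fin 2) (Fin 2) K))
    (hloc : ∀ v, ((HermitianLatticeTree.latticeTree σ ϖ ((StdForm.antidiagonal 2).over K)).neighborSet v).Finite)
    (hreg : ∀ v, ((HermitianLatticeTree.latticeTree σ ϖ ((StdForm.antidiagonal 2).over K)).neighborSet v).ncard = q + 1)
    (m : ℕ) :
    (-(q : ℂ)) ^ WithZero.log (Valued.v ((b - a) * (b - c))) *
        (({x : {M : Submodule 𝒪[K] (Fin 3 → K) // UnitaryLatticeTree.IsVertex σ ϖ ((StdForm.antidiagonal 3).over K) M} |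
              UnitaryLatticeTree.IsSelfDualLattice σ ϖ ((StdForm.antidiagonal 3).over K) x.1 ∧
                (UnitaryLatticeTree.latticeGraph σ ϖ ((StdForm.antidiagonal 3).over K)).dist x
                  (UnitaryLatticeTree.latticeGraphPerm σ ϖ ((StdForm.antidiagonal 3).over K) γ₁ x) = 2 * m}.ncard : ℂ) +
          ({x : {M : Submodule 𝒪[K] (Fin 3 → K) // UnitaryLatticeTree.IsVertex σ ϖ ((StdForm.antidiagonal 3).over K) M} |
              UnitaryLatticeTree.IsSelfDualLattice σ ϖ ((StdForm.antidiagonal 3).over K) x.1 ∧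
                (UnitaryLatticeTree.latticeGraph σ ϖ ((StdForm.antidiagonal 3).over K)).dist x
                  (UnitaryLatticeTree.latticeGraphPerm σ ϖ ((StdForm.antidiagonal 3).over K) γ₂ x) = 2 * m}.ncard : ℂ) -
          ({x : {M : Submodule 𝒪[K] (Fin 3 → K) // UnitaryLatticeTree.IsVertex σ ϖ ((StdForm.antidiagonal 3).over K) M} |
              UnitaryLatticeTree.IsSelfDualLattice σ ϖ ((StdForm.antidiagonal 3).over K) x.1 ∧
                (UnitaryLatticeTree.latticeGraph σ ϖ ((StdForm.antidiagonal 3).over K)).dist x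
                  (UnitaryLatticeTree.latticeGraphPerm σ ϖ ((StdForm.antidiagonal 3).over K) γ₃ x) = 2 * m}.ncard : ℂ) -
          ({x : {M : Submodule 𝒪[K] (Fin 3 → K) // UnitaryLatticeTree.IsVertex σ ϖ ((StdForm.antidiagonal 3).over K) M} |
              UnitaryLatticeTree.IsSelfDualLattice σ ϖ ((StdForm.antidiagonal 3).over K) x.1 ∧
                (UnitaryLatticeTree.latticeGraph σ ϖ ((StdForm.antidiagonal 3).over K)).dist x
                  (UnitaryLatticeTree.latticeGraphPerm σ ϖ ((StdForm.antidiagonal 3).over K) γ₄ x) = 2 * m}.ncard : ℂ)) =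
      (∑ k ∈ Finset.range (m + 1), xiHCoeff q m k *
          ({x : {M : Submodule (ValuativeRel.valuation K).integer (Fin 2 → K) // HermitianLatticeTree.IsSpecialLattice σ ϖ ((StdForm.antidiagonal 2).over K) M} |
              HermitianLatticeTree.IsSelfDualLattice σ ((StdForm.antidiagonal 2).over K) x.1 ∧
                (HermitianLatticeTree.latticeTree σ ϖ ((StdForm.antidiagonal 2).over K)).dist x
                  (HermitianLatticeTree.latticeTreeIso σ ϖ ((StdForm.antidiagonal 2).over K) δ₁ x) = 2 * k}.ncard : ℂ)) +
        ∑ k ∈ Finset.range (m + 1), xiHCoeff q m k *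
          ({x : {M : Submodule (ValuativeRel.valuation K).integer (Fin 2 → K) // HermitianLatticeTree.IsSpecialLattice σ ϖ ((StdForm.antidiagonal 2).over K) M} |
              HermitianLatticeTree.IsSelfDualLattice σ ((StdForm.antidiagonal 2).over K) x.1 ∧
                (HermitianLatticeTree.latticeTree σ ϖ ((StdForm.antidiagonal 2).over K)).dist x
                  (HermitianLatticeTree.latticeTreeIso σ ϖ ((StdForm.antidiagonal 2).over K) δ₂ x) = 2 * k}.ncard : ℂ) := by
  classical
  -- ruling (Q2): the instance letters of ★ counts B are BUILT here
  haveI := hfin₀₁.fintype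
  haveI := hfin₀₂.fintype
  haveI := hfin₀₃.fintype
  haveI := hfin₀₄.fintype
  haveI := finite_quotient_glInt_inf_conj_glInt hd hσO σk hσk hq hfrob g₁ hg₁
  have hr : Function.RightInverse
      (Quotient.out : ↥(unitaryGroupOfForm σ ((StdForm.antidiagonal 3).over K)) ⧸ (glInt 3 K).subgroupOf (unitaryGroupOfForm σ ((StdForm.antidiagonal 3).over K)) → ↥(unitaryGroupOfForm σ ((StdForm.antidiagonal 3).over K)))
      QuotientGroup.mk := fun x => QuotientGroup.out_eq' x
  -- the R-III letters, permuted for `t₃ = t_ϖ(a,c,b)` and `t₄ = t_ϖ(b,a,c)`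
  have hvba : Valued.v (b - a) = 1 := by rw [Valuation.map_sub_swap]; exact hvab
  have hvcb : Valued.v (c - b) = 1 := by rw [Valuation.map_sub_swap]; exact hvbc
  -- ★ counts B: the fixed-coset counts of the four literals
  obtain ⟨hV₀₁, hV₁₁⟩ := flickerFrame_natCard_fixedBy_one_of_separated hd g₁ hg₁ γ₁ hfin₁₁ horb₁ Quotient.out hr h2 h2e ha hb hc hvab hvac hvbc hγ₁
  obtain ⟨hV₀₂, hV₁₂⟩ := flickerFrame_natCard_fixedBy_pi_of_separated hd g₁ hg₁ γ₂ hfin₁₂ horb₂ Quotient.out hr h2 h2e ha hb hc hvab hvac hvbc hγ₂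
  obtain ⟨hV₀₃, hV₁₃⟩ := flickerFrame_natCard_fixedBy_pi_of_separated hd g₁ hg₁ γ₃ hfin₁₃ horb₃ Quotient.out hr h2 h2e ha hc hb hvac hvab hvcb hγ₃
  obtain ⟨hV₀₄, hV₁₄⟩ := flickerFrame_natCard_fixedBy_pi_of_separated hd g₁ hg₁ γ₄ hfin₁₄ horb₄ Quotient.out hr h2 h2e hb ha hc hvba hvbc hvac hγ₄
  -- `Φ = #Ball(x₀, 0) = 1`
  have hac : a ≠ c := fun h => by rw [h, sub_self, map_zero] at hvac; exact zero_ne_one hvac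
  have hn : Valued.v (a - c) = WithZero.exp (-((0 : ℕ) : ℤ)) := by rw [hvac, Nat.cast_zero, neg_zero, WithZero.exp_zero]
  have hΦ : {v | HermitianLatticeTree.latticeTreeIso σ ϖ ((StdForm.antidiagonal 2).over K) δ₁ v = v}.ncard = 1 := by
    rw [setOf_compression_fixed_eq_ball hd h2 h2e ha hc hn δ₁ hδ₁ x₀ hx₀]
    have hset : {v : {M : Submodule (ValuativeRel.valuation K).integer (Fin 2 → K) // HermitianLatticeTree.IsSpecialLattice σ ϖ ((StdForm.antidiagonal 2).over K) M} |
        (HermitianLatticeTree.latticeTree σ ϖ ((StdForm.antidiagonal 2).over K)).dist x₀ v ≤ 0} = {x₀} := by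
      haveI := isDiscreteValuationRing_integer_of_compatible hd.vϖ
      have hT := HermitianLatticeTree.isTree_latticeTree σ (valuation_map_eq_of_datum hd) (isUniformizingElement_of_v_eq hd.vϖ)
        (isUnimodular₂_antidiagonal_two (K := K))
      ext v
      simp only [Set.mem_setOf_eq, Nat.le_zero, Set.mem_singleton_iff, hT.connected.dist_eq_zero_iff]
      exact eq_comm
    rw [hset, Set.ncard_singleton]
  -- `Δ = 1`
  have hΔ : (-(q : ℂ)) ^ WithZero.log (Valued.v ((b - a) * (b - c))) = 1 := by
    rw [map_mul, hvba, hvbc, mul_one, WithZero.log_one, zpow_zero]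
  refine delta_mul_kappaSum_ncard_displaced_flicker_eq_sum_xiHCoeff_mul_ncard_displaced_two_of_unitLevels hd hσO σk hσk hq hfrob h2 h2e ha hb hc hac
    γ₁ γ₂ γ₃ γ₄ hγ₁ hγ₂ hγ₃ hγ₄ δ₁ δ₂ hδ₁ hδ₂ g₁ hg₁ hfin₀₁ hfin₁₁ hfin₀₂ hfin₁₂ hfin₀₃ hfin₁₃ hfin₀₄ hfin₁₄ x₀ hx₀ hloc hreg ?_ ?_ m
  · rw [hΔ, hV₀₁, hV₀₂, hV₀₃, hV₀₄, hΦ]; norm_num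
  · rw [hΔ, hV₁₁, hV₁₂, hV₁₃, hV₁₄, hΦ]; norm_num

end Separated

end Summit.HodgeConjecture.HodgeConjecture.R90.S6

end
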